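import Summits.QuantumFields.YangMills.Theorems.LuscherReductionTwistedTraceScalingBODefectOutRate
import Summits.QuantumFields.YangMills.Theorems.LuscherReductionTwistedTraceScalingBODefectTailSchedule
import Summits.QuantumFields.YangMills.Theorems.LuscherReductionTwistedTraceScalingBOCapProfile
import HarnessLib

/-!
# (C4-CORE γ-rates, FP-tail piece) THE FP-TAIL PIECE OVER THE CURRENCY FLOOR IS `o(λ_bare)`
# (lane A of S-BASE, crux `TwistedTraceScaling` stmt-QuantumFields-20203, C4-CORE, the (OD) pen; `pub/ym-fleet/ym-luscher-20007-p1/HANDOFF-g20.md` (γ))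

The coefficient of `(fpZ ε)^{-2}·∫φ²` in `…BODefectTailPiece.tail_sq_integral_le` at the record data of `…BODefectTailSchedule.eventually_tail_schedule`
(`δ = D_δβ^{-s}`, `α = β^{-1/2}ℓ²`, `P₀ = 13δ`, `N̄ = fpWeightBar(β^{-1})`, `κ_P = C_p(43β^{-s})²`) is `X_T'(β) = X_tail(β)²·c_g`,
`X_tail = e^{2β|E|}(e^{−βM_nt} + e^{−βM_far})·∫Ω_c dπ`; on the tail schedule `e^{−βM_nt} ≤ e^{−log⁴β/4}`, `e^{−βM_far} ≤ e^{−q₀log⁴β}`, so `X_T' ≤ e^{4β|E|}·4π(univ)²c_g·e^{−q'ℓ²}`,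
`q' = min(1/4, q₀)`.  ★★ `tail_rate_small` — `∀ a > 0, ∀ᶠ β, X_T'(β)/(c_R·β^{-K}·e^{4β|E|}) ≤ a·bareLambda(L³β)` (`…BODefectPieceRates.piece_rate_small`); the assembly applies
`…BODefectRateAlgebra.piece_le_rate_of_factor` with `Z_q = (fpZ ε)^{-2}` and `…BOCurrencyFloorZ.currency_floor_inv`.
HONEST FRAMING: bookkeeping for a stub of a child of the CONDITIONAL route R2b1; the hOD assembly, (B-ST), C4-CORE remain OPEN; not a gap, not Clay.
-/

set_option autoImplicit false

noncomputable section

open MeasureTheory Filter Topology Real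
open Literature.MathematicalPhysics.QuantumFieldTheory
open Literature.MathematicalPhysics.QuantumLattice

namespace Summit.QuantumFields.YangMills.Theorems.FemtoTransferGap.TwoLattice.ConstTube

open Summit.QuantumFields.YangMills.Theorems.FemtoTransferGap
open Summit.QuantumFields.YangMills.Theorems.FemtoTransferGap.TwoLattice
open Summit.QuantumFields.YangMills.Theorems.FemtoTransferGap.TwoLattice.Stiff
open Summit.QuantumFields.YangMills.Theorems.FemtoTransferGap.TwoLattice.GnChart

variable {L : ℕ} [NeZero L]

omit [NeZero L] in
/-- `e^{−q₀log⁴β} ≤ e^{−q₀ℓ²}` eventually (`ℓ = log β ≥ 1`), `q₀ ≥ 0`. [folklore] -/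
theorem exp_neg_mul_log_four_le {q₀ : ℝ} (hq : 0 ≤ q₀) : ∀ᶠ β : ℝ in atTop, Real.exp (-(q₀ * Real.log β ^ 4)) ≤ Real.exp (-(q₀ * btLog β ^ 2)) := by
  filter_upwards [eventually_btLog_eq] with β hℓ
  rw [Real.exp_le_exp, neg_le_neg_iff, ← hℓ]
  have h1 : 1 ≤ btLog β ^ 2 := one_le_pow₀ (one_le_btLog β)
  have h2 : btLog β ^ 4 = btLog β ^ 2 * btLog β ^ 2 := by ring
  have h3 : btLog β ^ 2 ≤ btLog β ^ 4 := by rw [h2]; nlinarith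
  exact mul_le_mul_of_nonneg_left h3 hq

/-- `(e^{2β})^{|E|} = e^{β·2|E|}`. [folklore] -/
theorem exp_two_pow_card_edge' (β : ℝ) : Real.exp (β * (2 * (Fintype.card (Edge 3 L) : ℝ))) = Real.exp (2 * β) ^ Fintype.card (Edge 3 L) := by
  rw [← Real.exp_nat_mul]; ring_nf

/-- `∫ Ω_c dπ ≤ π(univ)` (`0 ≤ Ω_c ≤ 1`). [folklore] -/
theorem integral_recordOmega_le (β : ℝ) :
    0 ≤ ∫ v, (fun x : LinkSpace L => {x : LinkSpace L | linkCurry x ∈ capBalancedSet L}.indicator (fun _ => (1 : ℝ)) x * frozenProfile L (fun β' => stiffGaussExp L (β' / 2) β') (fun β' => min (1 / 40) (powScale (1 / 2) β' * btLog β')) β x) (linkEmbed L v) ∂orthoTransverse L ∧ ∫ v, (fun x : LinkSpace L => {x : LinkSpace L | linkCurry x ∈ capBalancedSet L}.indicator (fun _ => (1 : ℝ)) x * frozenProfile L (fun β' => stiffGaussExp L (β' / 2) β') (fun β' => min (1 / 40) (powScale (1 / 2) β' * btLog β')) β x) (linkEmbed L v) ∂orthoTransverse L ≤ (orthoTransverse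 L Set.univ).toReal := by
  haveI := isFiniteMeasure_orthoTransverse L
  have hqf0 : ∀ β' x, 0 ≤ (fun β' => stiffGaussExp L (β' / 2) β') β' x := fun β' x => stiffGaussExp_nonneg _ _ x
  have hΩG0 : ∀ x, 0 ≤ frozenProfile L (fun β' => stiffGaussExp L (β' / 2) β') (fun β' => min (1 / 40) (powScale (1 / 2) β' * btLog β')) β x := fun x => (frozenProfile_mem_Icc hqf0 _ β x).1
  have hΩG1 : ∀ x, |frozenProfile L (fun β' => stiffGaussExp L (β' / 2) β') (fun β' => min (1 / 40) (powScale (1 / 2) β' * btLog β')) β x| ≤ 1 := abs_frozenProfile_le hqf0 _ β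
  have h0 : ∀ x, 0 ≤ (fun x : LinkSpace L => {x : LinkSpace L | linkCurry x ∈ capBalancedSet L}.indicator (fun _ => (1 : ℝ)) x * frozenProfile L (fun β' => stiffGaussExp L (β' / 2) β') (fun β' => min (1 / 40) (powScale (1 / 2) β' * btLog β')) β x) x := fun x => (capRestrict_mem (L := L) hΩG0 hΩG1 x).1
  have h1 : ∀ x, (fun x : LinkSpace L => {x : LinkSpace L | linkCurry x ∈ capBalancedSet L}.indicator (fun _ => (1 : ℝ)) x * frozenProfile L (fun β' => stiffGaussExp L (β' / 2) β') (fun β' => min (1 / 40) (powScale (1 / 2) β' * btLog β')) β x) x ≤ 1 := fun x => (le_abs_self _).trans (capRestrict_mem (L := L) hΩG0 hΩG1 x).2.2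
  refine ⟨integral_nonneg fun v => h0 _, ?_⟩
  have h := integral_mono_of_nonneg (μ := orthoTransverse L) (ae_of_all _ fun v => h0 (linkEmbed L v)) (integrable_const (1 : ℝ)) (ae_of_all _ fun v => h1 (linkEmbed L v))
  rw [integral_const, smul_eq_mul, mul_one, Measure.real] at h
  exact h

set_option maxHeartbeats 800000 in
-- explicit record expressions.
/-- ★★ **THE FP-TAIL PIECE IS `o(λ_bare)` OVER THE CURRENCY FLOOR** (see the module docstring): given the two tail-schedule bounds eventually (`…BODefectTailSchedule`),
the coefficient `X_tail²·c_g` over `c_R·β^{-K}·e^{4β|E|}` is eventually `≤ a·bareLambda(L³β)` for every `a > 0`. [cite: Luscher1983, §3] -/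
theorem tail_rate_small {s : ℝ} (hs : 0 < s) (Cp Dδ : ℝ) {q₀ : ℝ} (hq₀ : 0 < q₀) {cR : ℝ} (hcR : 0 < cR) (K : ℕ)
    (hsched : ∀ᶠ β : ℝ in atTop, Real.log β ^ 4 / 4 ≤ β * btMnt L (Dδ * powScale s β) (powScale (1 / 2) β * btLog β ^ 2) (min (1 / 40) (powScale (1 / 2) β * btLog β)) (5 * (powScale (1 / 2) β * btLog β ^ 2)) (powScale 1 β) ∧
      q₀ * Real.log β ^ 4 ≤ β * btMfar L (Dδ * powScale s β) (powScale (1 / 2) β * btLog β ^ 2) (min (1 / 40) (powScale (1 / 2) β * btLog β)) (powScale 1 β) (13 * (Dδ * powScale s β))) :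
    ∀ a : ℝ, 0 < a → ∀ᶠ β : ℝ in atTop,
      ((Real.exp (β * (2 * (Fintype.card (Edge 3 L) : ℝ))) * (Real.exp (-(β * btMnt L (Dδ * powScale s β) (powScale (1 / 2) β * btLog β ^ 2) (min (1 / 40) (powScale (1 / 2) β * btLog β)) (5 * (powScale (1 / 2) β * btLog β ^ 2)) (powScale 1 β))) + Real.exp (-(β * btMfar L (Dδ * powScale s β) (powScale (1 / 2) β * btLog β ^ 2) (min (1 / 40) (powScale (1 / 2) β * btLog β)) (powScale 1 β) (13 * (Dδ * powScale s β))))) * ∫ v, (fun x : LinkSpace L => {x : LinkSpace L | linkCurry x ∈ capBalancedSet L}.indicator (fun _ => (1 : ℝ)) x * frozenProfile L (fun β' => stiffGaussExp L (β' / 2) β') (fun β' => min (1 / 40) (powScale (1 / 2) β' * btLog β')) β x) (linkEmbed L v) ∂orthoTransverse L) ^ 2 * (1 / (fpWeightBar L (powScale 1 β) * (1 - Cp * (43 * powScale s β) ^ 2)))) /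
        (cR * powScale 1 β ^ K * (Real.exp (2 * β) ^ Fintype.card (Edge 3 L)) ^ 2) ≤ a * bareLambda ((L : ℝ) ^ 3 * β) := by
  haveI := isFiniteMeasure_orthoTransverse L
  set q : ℝ := min (1 / 4) q₀ with hqdef
  have hq0 : 0 < q := lt_min (by norm_num) hq₀
  have hq1 : q ≤ 1 / 4 := min_le_left _ _
  have hq2 : q ≤ q₀ := min_le_right _ _
  set Pm : ℝ := (orthoTransverse L Set.univ).toReal with hPm
  have hPm0 : 0 ≤ Pm := ENNReal.toReal_nonneg
  set c₀i : ℝ := Real.sqrt (gramDet L 0) / ((2 * π ^ 2)⁻¹) ^ Fintype.card (NzSite L) with hc₀i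
  have hc₀i0 : 0 ≤ c₀i := by rw [hc₀i]; positivity
  set Q : ℝ → ℝ := fun β => 4 * Pm ^ 2 * (1 / (fpWeightBar L (powScale 1 β) * (1 - Cp * (43 * powScale s β) ^ 2))) with hQ
  have hκ : ∀ᶠ β : ℝ in atTop, Cp * (43 * powScale s β) ^ 2 ≤ 1 / 2 := by
    have h := ((tendsto_powScale hs).const_mul 43).pow 2 |>.const_mul Cp
    rw [mul_zero, zero_pow two_ne_zero, mul_zero] at h
    exact h.eventually (eventually_le_nhds (by norm_num))
  refine piece_rate_small (L := L) hq0 (P := 4 * Pm ^ 2 * (2 * c₀i)) (by positivity) hcR (flatDim L) K (Q := Q) ?_ ?_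
  · filter_upwards [hsched, hκ, exp_neg_log_four_le, exp_neg_mul_log_four_le hq₀.le] with β ⟨hnt, hfar⟩ hκβ hl4 hl4q
    set EK : ℝ := Real.exp (2 * β) ^ Fintype.card (Edge 3 L) with hEK
    have hN : 0 < fpWeightBar L (powScale 1 β) := fpWeightBar_pos L (powScale_pos 1 β)
    have hcg0 : 0 ≤ 1 / (fpWeightBar L (powScale 1 β) * (1 - Cp * (43 * powScale s β) ^ 2)) := by
      apply div_nonneg zero_le_one; apply mul_nonneg hN.le; linarith
    obtain ⟨hI0, hI1⟩ := integral_recordOmega_le (L := L) β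
    have hℓ : 0 ≤ btLog β ^ 2 := sq_nonneg _
    set X : ℝ := Real.exp (-(q * btLog β ^ 2)) with hX
    -- the two exponentials
    have e1 : Real.exp (-(β * btMnt L (Dδ * powScale s β) (powScale (1 / 2) β * btLog β ^ 2) (min (1 / 40) (powScale (1 / 2) β * btLog β)) (5 * (powScale (1 / 2) β * btLog β ^ 2)) (powScale 1 β))) ≤ X := by
      refine le_trans ?_ (hl4.trans ?_)
      · rw [Real.exp_le_exp, neg_le_neg_iff]; exact hnt
      · rw [hX, Real.exp_le_exp, neg_le_neg_iff]; exact mul_le_mul_of_nonneg_right hq1 hℓ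
    have e2 : Real.exp (-(β * btMfar L (Dδ * powScale s β) (powScale (1 / 2) β * btLog β ^ 2) (min (1 / 40) (powScale (1 / 2) β * btLog β)) (powScale 1 β) (13 * (Dδ * powScale s β)))) ≤ X := by
      refine le_trans ?_ (hl4q.trans ?_)
      · rw [Real.exp_le_exp, neg_le_neg_iff]; exact hfar
      · rw [hX, Real.exp_le_exp, neg_le_neg_iff]; exact mul_le_mul_of_nonneg_right hq2 hℓ
    have hX0 : 0 ≤ X := (Real.exp_pos _).le
    have hX1 : X ≤ 1 := Real.exp_le_one_iff.mpr (by nlinarith)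
    have hsum0 : 0 ≤ Real.exp (-(β * btMnt L (Dδ * powScale s β) (powScale (1 / 2) β * btLog β ^ 2) (min (1 / 40) (powScale (1 / 2) β * btLog β)) (5 * (powScale (1 / 2) β * btLog β ^ 2)) (powScale 1 β))) + Real.exp (-(β * btMfar L (Dδ * powScale s β) (powScale (1 / 2) β * btLog β ^ 2) (min (1 / 40) (powScale (1 / 2) β * btLog β)) (powScale 1 β) (13 * (Dδ * powScale s β)))) := by positivity
    have hsum : Real.exp (-(β * btMnt L (Dδ * powScale s β) (powScale (1 / 2) β * btLog β ^ 2) (min (1 / 40) (powScale (1 / 2) β * btLog β)) (5 * (powScale (1 / 2) β * btLog β ^ 2)) (powScale 1 β))) + Real.exp (-(β * btMfar L (Dδ * powScale s β) (powScale (1 / 2) β * btLog β ^ 2) (min (1 / 40) (powScale (1 / 2) β * btLog β)) (powScale 1 β) (13 * (Dδ * powScale s β)))) ≤ 2 * X := by linarith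
    have hE : Real.exp (β * (2 * (Fintype.card (Edge 3 L) : ℝ))) = EK := exp_two_pow_card_edge' (L := L) β
    -- `X_tail ≤ EK·2X·Pm`, so `X_tail² ≤ EK²·4X²Pm² ≤ EK²·4Pm²·X`
    have hXT0 : 0 ≤ (Real.exp (β * (2 * (Fintype.card (Edge 3 L) : ℝ))) * (Real.exp (-(β * btMnt L (Dδ * powScale s β) (powScale (1 / 2) β * btLog β ^ 2) (min (1 / 40) (powScale (1 / 2) β * btLog β)) (5 * (powScale (1 / 2) β * btLog β ^ 2)) (powScale 1 β))) + Real.exp (-(β * btMfar L (Dδ * powScale s β) (powScale (1 / 2) β * btLog β ^ 2) (min (1 / 40) (powScale (1 / 2) β * btLog β)) (powScale 1 β) (13 * (Dδ * powScale s β))))) * ∫ v, (fun x : LinkSpace L => {x : LinkSpace L | linkCurry x ∈ capBalancedSet L}.indicator (fun _ => (1 : ℝ)) x * frozenProfile L (fun β' => stiffGaussExp L (β' / 2) β') (fun β' => min (1 / 40) (powScale (1 / 2) β' * btLog β')) β x) (linkEmbed L v) ∂orthoTransverse L) := by positivity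
    have hXT : (Real.exp (β * (2 * (Fintype.card (Edge 3 L) : ℝ))) * (Real.exp (-(β * btMnt L (Dδ * powScale s β) (powScale (1 / 2) β * btLog β ^ 2) (min (1 / 40) (powScale (1 / 2) β * btLog β)) (5 * (powScale (1 / 2) β * btLog β ^ 2)) (powScale 1 β))) + Real.exp (-(β * btMfar L (Dδ * powScale s β) (powScale (1 / 2) β * btLog β ^ 2) (min (1 / 40) (powScale (1 / 2) β * btLog β)) (powScale 1 β) (13 * (Dδ * powScale s β))))) * ∫ v, (fun x : LinkSpace L => {x : LinkSpace L | linkCurry x ∈ capBalancedSet L}.indicator (fun _ => (1 : ℝ)) x * frozenProfile L (fun β' => stiffGaussExp L (β' / 2) β') (fun β' => min (1 / 40) (powScale (1 / 2) β' * btLog β')) β x) (linkEmbed L v) ∂orthoTransverse L) ≤ EK * (2 * X) * Pm := by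
      rw [hE]; exact mul_le_mul (mul_le_mul_of_nonneg_left hsum (by positivity)) hI1 hI0 (by positivity)
    have hXT2 : (Real.exp (β * (2 * (Fintype.card (Edge 3 L) : ℝ))) * (Real.exp (-(β * btMnt L (Dδ * powScale s β) (powScale (1 / 2) β * btLog β ^ 2) (min (1 / 40) (powScale (1 / 2) β * btLog β)) (5 * (powScale (1 / 2) β * btLog β ^ 2)) (powScale 1 β))) + Real.exp (-(β * btMfar L (Dδ * powScale s β) (powScale (1 / 2) β * btLog β ^ 2) (min (1 / 40) (powScale (1 / 2) β * btLog β)) (powScale 1 β) (13 * (Dδ * powScale s β))))) * ∫ v, (fun x : LinkSpace L => {x : LinkSpace L | linkCurry x ∈ capBalancedSet L}.indicator (fun _ => (1 : ℝ)) x * frozenProfile L (fun β' => stiffGaussExp L (β' / 2) β') (fun β' => min (1 / 40) (powScale (1 / 2) β' * btLog β')) β x) (linkEmbed L v) ∂orthoTransverse L) ^ 2 ≤ EK ^ 2 * (4 * Pm ^ 2) * X := by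
      have h1 := pow_le_pow_left₀ hXT0 hXT 2
      have h2 : (EK * (2 * X) * Pm) ^ 2 = EK ^ 2 * (4 * Pm ^ 2) * (X * X) := by ring
      have h3 : X * X ≤ X := by nlinarith
      calc _ ≤ (EK * (2 * X) * Pm) ^ 2 := h1
        _ = EK ^ 2 * (4 * Pm ^ 2) * (X * X) := h2
        _ ≤ EK ^ 2 * (4 * Pm ^ 2) * X := mul_le_mul_of_nonneg_left h3 (by positivity)
    calc (Real.exp (β * (2 * (Fintype.card (Edge 3 L) : ℝ))) * (Real.exp (-(β * btMnt L (Dδ * powScale s β) (powScale (1 / 2) β * btLog β ^ 2) (min (1 / 40) (powScale (1 / 2) β * btLog β)) (5 * (powScale (1 / 2) β * btLog β ^ 2)) (powScale 1 β))) + Real.exp (-(β * btMfar L (Dδ * powScale s β) (powScale (1 / 2) β * btLog β ^ 2) (min (1 / 40) (powScale (1 / 2) β * btLog β)) (powScale 1 β) (13 * (Dδ * powScale s β))))) * ∫ v, (fun x : LinkSpace L => {x : LinkSpace L | linkCurry x ∈ capBalancedSet L}.indicator (fun _ => (1 : ℝ)) x * frozenProfile L (fun β' => stiffGaussExp L (β'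 / 2) β') (fun β' => min (1 / 40) (powScale (1 / 2) β' * btLog β')) β x) (linkEmbed L v) ∂orthoTransverse L) ^ 2 * (1 / (fpWeightBar L (powScale 1 β) * (1 - Cp * (43 * powScale s β) ^ 2)))
        ≤ EK ^ 2 * (4 * Pm ^ 2) * X * (1 / (fpWeightBar L (powScale 1 β) * (1 - Cp * (43 * powScale s β) ^ 2))) := mul_le_mul_of_nonneg_right hXT2 hcg0
      _ = EK ^ 2 * Q β * X := by simp only [hQ]; ring
  · filter_upwards [hκ] with β hκβ
    have hN : 0 < fpWeightBar L (powScale 1 β) := fpWeightBar_pos L (powScale_pos 1 β)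
    have hps : 0 < powScale 1 β := powScale_pos 1 β
    have h1κ : 1 / 2 ≤ 1 - Cp * (43 * powScale s β) ^ 2 := by linarith
    have hcg : 1 / (fpWeightBar L (powScale 1 β) * (1 - Cp * (43 * powScale s β) ^ 2)) ≤ 2 * c₀i / powScale 1 β ^ flatDim L := by
      have hi := inv_fpWeightBar_le (L := L) β
      rw [← hc₀i] at hi
      calc 1 / (fpWeightBar L (powScale 1 β) * (1 - Cp * (43 * powScale s β) ^ 2)) ≤ 1 / (fpWeightBar L (powScale 1 β) * (1 / 2)) :=
            one_div_le_one_div_of_le (by positivity) (mul_le_mul_of_nonneg_left h1κ hN.le)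
        _ = 2 * (1 / fpWeightBar L (powScale 1 β)) := by field_simp
        _ ≤ 2 * (c₀i / powScale 1 β ^ flatDim L) := by linarith
        _ = 2 * c₀i / powScale 1 β ^ flatDim L := by ring
    refine ⟨by simp only [hQ]; positivity, ?_⟩
    calc Q β = 4 * Pm ^ 2 * (1 / (fpWeightBar L (powScale 1 β) * (1 - Cp * (43 * powScale s β) ^ 2))) := rfl
      _ ≤ 4 * Pm ^ 2 * (2 * c₀i / powScale 1 β ^ flatDim L) := by gcongr
      _ = 4 * Pm ^ 2 * (2 * c₀i) / powScale 1 β ^ flatDim L := by field_simp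

end Summit.QuantumFields.YangMills.Theorems.FemtoTransferGap.TwoLattice.ConstTube

end
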